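import Summits.CriticalPhenomena.PercolationContinuityZ3.Theorems.FK.Transplant.KNFreeLawSupport
import Summits.CriticalPhenomena.PercolationContinuityZ3.Theorems.FK.Transplant.KNFreePinning
import Literature.Probability.LatticeModels.RandomClusterExploredWiring
import Literature.Probability.LatticeModels.RandomClusterEdgeWeightsHomogeneous
import HarnessLib

/-!
# FRONTIER TRANSPLANT, binder 1 (FH) calibration — the free look with its WIRED SEED is a homogeneous
# random-cluster measure: `fkLaw ℓQ (hitW p) q = φ^{Λ_m}_{⟨E(ℓQ) ∖ E(Λ_m)⟩, p, q}` read through `η ↦ η ∪ E(Λ_m)`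

Registered R99 (cell INBOX l.6817, 2026-08-24); registry row T1i; label T1i-A (coordinator fk-4 g205 = the lead′s suggestion L162; the lead may restyle the label on its record line).
builds on p205010 (kernel theorem, internal audit signed; external expert review pending). CONDITIONAL sub-cell
(FH AND TP_FK open at the same `p` for `q > 1` near `p_c(q)`; ⇔ GRC Conj. (5.103) via K1); the transplant is a typed
reduction, not a proof of FK continuity. Support file (`--supports stmt-CriticalPhenomena-4575`, helper) typed by the
FRONTIER TRANSPLANT seat `prim-bschramm-fkt-p2` (`fk-continuity/transplant/`). No definitions, no named facts, no
sorries; standard axioms.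

HONEST FRAMING (page 1, cell rule). Everything in this file is UNCONDITIONAL finite-volume random-cluster theory
(`q > 0`). It does NOT touch the transplant's theorem of record `ufsc0_of_freeBoundaryHypothesis_r3` (p248245,
« 2 / 0 ☑ »), which stays CONDITIONAL on FH AND TP_FK (barrier note
`Literature.Barriers.CriticalPhenomena.SamePFreeBoundaryCriteria`); not a binder discharge, not a re-cut, not `_r4`;
`n_open = 2`, BINDER-OWNERS, FO-19 NO-GO unchanged. K1 (verbatim): "[C3a ∀ p > p_c(q)] ∧ C3b ⇒ p̂_c(q) = p_c(q) =
GRC Conj (5.103) = DT Question 5 (open for q ∈ (1,2))".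

## What is here

The hypothesis of record `FH d q p` (`FreeBoundaryHypotheses.lean`) is a statement about ONE family of finite-volume
laws: `fkLaw (g.Qset ℓ 0) (hitW p g ℓ m 0) q` — the random-cluster measure with edge parameters (`rcMeasureW`,
Grimmett (1.20)) of the box `ℓQ`, parameter `p` on its lattice edges, parameter `1` (pinned open) on the lattice
edges of the seed `Λ_m`, `0` elsewhere, no wired vertex. Every comparison of binder 1 in the tree so far (T1, T1b,
T1c, T1q, T1h) is EDGE BY EDGE (Grimmett (3.22)/(3.23), Holley), which is blind to the seed. The comparison of
(3.25)/(3.28) type behind STRICT monotonicity in `q` (T1m `rcMeasure_real_le_of_slope`) is a statement about the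
HOMOGENEOUS measure `φ^B_{G,p,q} = rcMeasure G p q B` with a wired vertex set `B`. This file is the exact bridge:

§1 (any finite graph `G`, `0 < p ≤ 1`, `0 < q`). Let `S ⊆ E(G)` ("seed edges") span a vertex set `W ∋ x₀` (both
end points of every seed edge in `W`, every vertex of `W` joined to `x₀` through seed edges). Then for EVERY event `L`,
`φ^∅_{condWeights (p·1_{E(G)}) (E(G)∖S) S, q}(L) = φ^W_{⟨E(G) ∖ S⟩, p, q}({η | η ∪ S ∈ L})`
(`rcMeasureW_condWeights_real_eq_rcMeasure_fromEdgeSet`): pinning the seed edges OPEN is the same as DELETING them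
and WIRING the seed. Proof = Grimmett Thm. (3.7) (tree `rcMeasureW_real_inter_cylinder`: the pinned law is the
conditional law given the cylinder `{ω ∖ (E(G)∖S) = S}`) + the domain Markov property with the wiring induced by
explored open edges (tree `rcMeasure_real_inter_cylinder_eq_mul_fromEdgeSet_of_reachable`, Grimmett Lemma (4.13);
a one-point wired set is no wiring, `rcMeasure_singleton_eq_empty`) + positivity of the cylinder.
§2 (`ℤ^d`). The free-look weighting `restrW Q (pinW (lattW p) E(Λ) E(Λ))` (`hitW`), read on the pairs of `Q`, IS the
conditional parameter vector of §1 for the induced graph of `Q` with seed edges `E(Q) ∩ E(Λ)`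
(`restrW_pinW_lattW_comp_sym2Map_eq_condWeights`).
§3 (`ℤ^d`). The seed `Q ∩ Λ_m` of an origin-star-convex region `Q ∋ 0` is joined to `0` through seed edges
(`seed_reachable_zero`; coordinate descent as in the tree's `box_induce_reachable_zero`); boxes `ℓQ ∋ 0` are
origin-star-convex (`update_mem_Qset_of_between`).
§4 **The bridge** `fkLaw_hitW_real_eq_rcMeasure_seedWired`: for `0 ∈ ℓQ_g`, `0 < p`, `0 < q` and measurable `A`,
`fkLaw ℓQ (hitW p g ℓ m 0) q (A) = φ^{Λ_m ∩ ℓQ}_{⟨E(ℓQ) ∖ E(Λ_m)⟩, p, q}({η | η ∪ (E(ℓQ) ∩ E(Λ_m)) ∈ liftEdges⁻¹ A})`.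
Consumer: `FHThresholdStrictMono.lean` (binder 1's threshold `p_FH(q; d)` is STRICTLY increasing in `q`).

## References

* G. Grimmett, *The Random-Cluster Model*, Springer 2006: §1.4 eq. (1.20) p. 15; Thm. (3.7) p. 39; §4.2
  (4.11)–(4.13), Lemma (4.13) p. 71; Thm. (3.24), Thm. (5.10). [Grimmett2006]
* G. Kozma, S. Nitzan, arXiv:2401.12397 (2024), §4 p. 16 (hittable geometry: `Λ_m ↔ ℓF` inside `ℓQ`). [KozmaNitzan2024]
-/

noncomputable section

open MeasureTheory Finset SimpleGraph
open scoped ENNReal Classical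

namespace Summit.CriticalPhenomena.PercolationContinuityZ3.Theorems.FK

open Literature.Probability.Percolation Literature.Probability.LatticeModels
open Literature.Probability.Percolation.GadgetSystem Literature.Probability.Percolation.KozmaNitzan

/-! ### §1 Pinning the seed edges open = deleting them and wiring the seed (any finite graph) -/

section SeedWired

variable {V : Type*} [Fintype V] [DecidableEq V] (G : SimpleGraph V) [DecidableRel G.Adj]

/-- A one-point wired set is no wiring: `φ^{{x₀}}_{G,p,q} = φ^∅_{G,p,q}` (the cluster counts agree,
tree `clusterCount_singleton`). [cite: Grimmett2006, §4.2 (wired vertex sets)] -/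
theorem rcMeasure_singleton_eq_empty (p q : ℝ) (x₀ : V) :
    rcMeasure G p q ({x₀} : Set V) = rcMeasure G p q (∅ : Set V) := by
  have hwired : wired ({x₀} : Set V) = wired (∅ : Set V) := by
    ext a b
    simp only [wired_adj, Set.mem_singleton_iff, Set.mem_empty_iff_false, and_false, iff_false, not_and]
    rintro hab rfl rfl
    exact hab rfl
  have hw : ∀ ω, rcWeight G p q ({x₀} : Set V) ω = rcWeight G p q ∅ ω := fun ω => by
    simp only [rcWeight, clusterCount, hwired]
  have hZ : rcPartitionFunction G p q ({x₀} : Set V) = rcPartitionFunction G p q ∅ := by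
    simp only [rcPartitionFunction, hw]
  simp only [rcMeasure, hw, hZ]

/-- The cylinder "exactly the seed edges are open off the fresh region" has positive `φ^∅_{G,p,q}`-probability
for `0 < p` (it contains the all-open configuration `E(G)`). [cite: Grimmett2006, §1.2 eq. (1.2)] -/
theorem rcMeasure_real_seedCylinder_pos {p : ℝ} (hp : p ∈ Set.Icc (0 : ℝ) 1) (hp0 : 0 < p) {q : ℝ} (hq : 0 < q)
    (B : Set V) {S : Finset (Sym2 V)} (hS : S ⊆ G.edgeFinset) :
    0 < (rcMeasure G p q B).real {ω : BondConfig V | ω \ ↑(G.edgeFinset \ S) = ↑S} := by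
  set C : Set (BondConfig V) := {ω : BondConfig V | ω \ ↑(G.edgeFinset \ S) = ↑S} with hC
  have hZ := rcPartitionFunction_pos G hp hq B
  rw [rcMeasure_real_apply G hp hq B C]
  have hmem : (↑G.edgeFinset : BondConfig V) ∈ C := by
    show (↑G.edgeFinset : Set (Sym2 V)) \ ↑(G.edgeFinset \ S) = ↑S
    rw [Finset.coe_sdiff, Set.sdiff_sdiff_right_self, Set.inter_eq_right]
    exact Finset.coe_subset.2 hS
  refine lt_of_lt_of_le ?_ (Finset.single_le_sum (f := fun ω : Finset (Sym2 V) =>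
    if (↑ω : BondConfig V) ∈ C then rcWeight G p q B ω / rcPartitionFunction G p q B else 0)
    (fun ω _ => ?_) (Finset.mem_powerset_self G.edgeFinset))
  · rw [if_pos hmem]
    refine div_pos ?_ hZ
    simp only [rcWeight, Finset.sdiff_self, Finset.card_empty, pow_zero, mul_one]
    positivity
  · split_ifs
    · exact div_nonneg (rcWeight_nonneg G hp hq.le B ω) hZ.le
    · exact le_rfl

/-- **Pinning the seed edges open is the same as deleting them and wiring the seed.** Let `0 < p ≤ 1`, `0 < q`,
`S ⊆ E(G)` a set of "seed edges" all of whose end points lie in `W`, and `x₀ ∈ W` a vertex to which every vertex of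
`W` is joined through edges of `S`. Then for EVERY event `L`: the random-cluster law with parameters `p` on
`E(G) ∖ S`, `1` on `S`, `0` elsewhere and nothing wired gives `L` the probability that the homogeneous measure
`φ^W_{⟨E(G) ∖ S⟩, p, q}` (seed edges deleted, seed wired) gives to `{η | η ∪ S ∈ L}`. (Thm. (3.7): the pinned law
is `φ^∅_{G,p,q}` conditioned on the cylinder `{ω ∖ (E(G) ∖ S) = S}`; Lemma (4.13) with the wiring induced by the
open edges `S` hanging off `{x₀}`; a one-point wired set is no wiring.)
[cite: Grimmett2006, Thm. (3.7) (p. 39) and Lemma (4.13) (p. 71)] -/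
theorem rcMeasureW_condWeights_real_eq_rcMeasure_fromEdgeSet (p : unitInterval) (hp0 : 0 < (p : ℝ))
    {q : ℝ} (hq : 0 < q) {S : Finset (Sym2 V)} (hS : S ⊆ G.edgeFinset) {W : Set V} {x₀ : V} (hx₀ : x₀ ∈ W)
    (hSW : ∀ e ∈ S, ∀ x ∈ e, x ∈ W)
    (hW : ∀ x ∈ W, (fromEdgeSet (↑S : Set (Sym2 V))).Reachable x x₀) (L : Set (BondConfig V)) :
    (rcMeasureW (condWeights (edgeIndicatorWeights G p) ↑(G.edgeFinset \ S) ↑S) q (∅ : Set V)).real L =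
      (rcMeasure (fromEdgeSet (↑(G.edgeFinset \ S) : Set (Sym2 V))) p q W).real
        {η : BondConfig V | η ∪ ↑S ∈ L} := by
  have hpI : (p : ℝ) ∈ Set.Icc (0 : ℝ) 1 := p.2
  set U : Finset (Sym2 V) := G.edgeFinset \ S with hU_def
  set C : Set (BondConfig V) := {ω : BondConfig V | ω \ ↑U = ↑S} with hC
  have hdisj : Disjoint (↑S : Set (Sym2 V)) ↑U := by
    rw [Finset.disjoint_coe, hU_def]; exact Finset.disjoint_sdiff
  -- Thm. (3.7): the pinned law is the conditional law given the cylinder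
  have h37 := rcMeasureW_real_inter_cylinder (edgeIndicatorWeights G p) hq (∅ : Set V) hdisj L
  rw [← rcMeasure_eq_rcMeasureW G p hq ∅] at h37
  -- the event on the cylinder, read on the fresh region
  have hLC : L ∩ C = {ω : BondConfig V | ω ∩ ↑U ∈ {η : BondConfig V | η ∪ ↑S ∈ L}} ∩
      {ω : BondConfig V | ω ∩ (↑U : Set (Sym2 V))ᶜ = ↑S} := by
    ext ω
    simp only [Set.mem_inter_iff, Set.mem_setOf_eq, hC, Set.sdiff_eq]
    constructor
    · rintro ⟨hL, hω⟩
      refine ⟨?_, hω⟩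
      rwa [← hω, Set.inter_union_compl]
    · rintro ⟨hL, hω⟩
      refine ⟨?_, hω⟩
      rwa [← hω, Set.inter_union_compl] at hL
  have hC' : C = {ω : BondConfig V | ω ∩ (↑U : Set (Sym2 V))ᶜ = ↑S} := by
    ext ω; simp only [hC, Set.mem_setOf_eq, Set.sdiff_eq]
  -- Lemma (4.13) with the wiring induced by the seed edges hanging off `{x₀}`
  have hUE : U ⊆ G.edgeFinset := Finset.sdiff_subset
  have hSU : S ⊆ G.edgeFinset \ U := by
    intro e he
    rw [Finset.mem_sdiff]
    exact ⟨hS he, fun h => (Finset.mem_sdiff.1 h).2 he⟩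
  have hEW := rcMeasure_real_inter_cylinder_eq_mul_fromEdgeSet_of_reachable G hpI hq U hUE hSU
    (Set.singleton_subset_iff.2 hx₀) hSW (fun x hx => ⟨x₀, rfl, hW x hx⟩) {η : BondConfig V | η ∪ ↑S ∈ L}
  rw [rcMeasure_singleton_eq_empty, ← hLC, ← hC'] at hEW
  have hCpos : 0 < (rcMeasure G (p : ℝ) q (∅ : Set V)).real C :=
    rcMeasure_real_seedCylinder_pos G hpI hp0 hq ∅ hS
  have key := h37.symm.trans hEW
  convert mul_left_cancel₀ hCpos.ne' key using 2

end SeedWired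

/-! ### §2 The free-look weighting of the transplant is such a conditional parameter vector -/

section Weights

variable {d : ℕ}

/-- **The free look's parameters, read on the pairs of `Q`, are conditional parameters of the induced graph**:
`p` on the lattice edges of `Q` off the seed, `1` on the lattice edges of `Q` inside `Λ = v + Λ_m` (the seed edges
`E(Q) ∩ E(Λ)`), `0` on every other pair (non-edges and the diagonal). [cite: Grimmett2006, §1.4 eq. (1.20) (p. 15), Thm. (3.7) (p. 39); KozmaNitzan2024, §4 p. 16] -/
theorem restrW_pinW_lattW_comp_sym2Map_eq_condWeights (p : unitInterval) (Q : Finset (Site d)) (v : Site d) (m : ℕ) :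
    (fun e : Sym2 ↥Q => restrW (↑Q : Set (Site d))
        (pinW (lattW d p) ↑(edgesIn (zdGraph d) (GM.ball v m)) ↑(edgesIn (zdGraph d) (GM.ball v m)))
        (Sym2.map Subtype.val e)) =
      condWeights (edgeIndicatorWeights (finsetGraph (zdGraph d) Q) p)
        ↑((finsetGraph (zdGraph d) Q).edgeFinset \
            (finsetGraph (zdGraph d) Q).edgeFinset.filter
              (fun e => Sym2.map Subtype.val e ∈ edgesIn (zdGraph d) (GM.ball v m)))
        ↑((finsetGraph (zdGraph d) Q).edgeFinset.filter
            (fun e => Sym2.map Subtype.val e ∈ edgesIn (zdGraph d) (GM.ball v m))) := by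
  set G := finsetGraph (zdGraph d) Q with hG
  set E : Finset (Sym2 (Site d)) := edgesIn (zdGraph d) (GM.ball v m) with hE
  set S : Finset (Sym2 ↥Q) := G.edgeFinset.filter (fun e => Sym2.map Subtype.val e ∈ E) with hS
  funext e
  induction e using Sym2.ind with
  | h x y =>
    rw [Sym2.map_mk]
    have hmemS : s(x, y) ∈ (↑S : Set (Sym2 ↥Q)) ↔ (zdGraph d).Adj x.1 y.1 ∧ s(x.1, y.1) ∈ E := by
      rw [Finset.mem_coe, hS, Finset.mem_filter, SimpleGraph.mem_edgeFinset, SimpleGraph.mem_edgeSet,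
        Sym2.map_mk]
      exact Iff.rfl
    have hmemU : s(x, y) ∈ (↑(G.edgeFinset \ S) : Set (Sym2 ↥Q)) ↔ (zdGraph d).Adj x.1 y.1 ∧ s(x.1, y.1) ∉ E := by
      rw [Finset.mem_coe, Finset.mem_sdiff, SimpleGraph.mem_edgeFinset, SimpleGraph.mem_edgeSet, ← Finset.mem_coe,
        hmemS]
      constructor
      · rintro ⟨h, h'⟩; exact ⟨h, fun hE' => h' ⟨h, hE'⟩⟩
      · rintro ⟨h, h'⟩; exact ⟨h, fun hE' => h' hE'.2⟩
    by_cases hxy : x.1 = y.1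
    · -- the diagonal
      have hnadj : ¬ (zdGraph d).Adj x.1 y.1 := fun h => h.ne hxy
      have hnw : s(x.1, y.1) ∉ wireSet (↑Q : Set (Site d)) := fun h => h.2 (by rw [Sym2.mk_isDiag_iff]; exact hxy)
      rw [restrW_apply_of_not_mem _ hnw,
        condWeights_of_not_mem_of_not_mem _ (fun h => hnadj (hmemU.1 h).1) (fun h => hnadj (hmemS.1 h).1)]
    · have hw : s(x.1, y.1) ∈ wireSet (↑Q : Set (Site d)) := by
        refine ⟨fun z hz => ?_, by rw [Sym2.mk_isDiag_iff]; exact hxy⟩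
        rcases Sym2.mem_iff.1 hz with rfl | rfl
        · exact x.2
        · exact y.2
      rw [restrW_apply_of_mem _ hw]
      by_cases heE : s(x.1, y.1) ∈ (↑E : Set (Sym2 (Site d)))
      · have hadj : (zdGraph d).Adj x.1 y.1 := by
          have := (mem_edgesIn_iff.1 (Finset.mem_coe.1 heE)).1
          rwa [SimpleGraph.mem_edgeSet] at this
        rw [pinW_apply_of_mem_of_mem _ heE heE,
          condWeights_of_not_mem_of_mem _ (fun h => (hmemU.1 h).2 (Finset.mem_coe.1 heE))
            (hmemS.2 ⟨hadj, Finset.mem_coe.1 heE⟩)]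
      · rw [pinW_apply_of_not_mem _ _ heE, lattW_mk]
        by_cases hadj : (zdGraph d).Adj x.1 y.1
        · rw [if_pos hadj, condWeights_of_mem _ _ (hmemU.2 ⟨hadj, fun h => heE (Finset.mem_coe.2 h)⟩)]
          unfold edgeIndicatorWeights
          rw [if_pos (by rw [SimpleGraph.mem_edgeSet]; exact hadj)]
        · rw [if_neg hadj,
            condWeights_of_not_mem_of_not_mem _ (fun h => hadj (hmemU.1 h).1) (fun h => hadj (hmemS.1 h).1)]

/-- The free-look weighting `hitW` of the transplant is the weighting of
`restrW_pinW_lattW_comp_sym2Map_eq_condWeights` with `Q = v + ℓQ_g`. [cite: KozmaNitzan2024, §4 p. 16 (hittable geometry)] -/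
theorem hitW_eq_restrW_pinW (p : unitInterval) (g : Geom d) (ℓ m : ℕ) (v : Site d) :
    hitW p g ℓ m v = restrW (↑(g.Qset ℓ v) : Set (Site d))
      (pinW (lattW d p) ↑(edgesIn (zdGraph d) (GM.ball v m)) ↑(edgesIn (zdGraph d) (GM.ball v m))) :=
  rfl

/-- Both end points of a seed edge lie in the seed. [folklore] -/
theorem mem_ball_of_mem_seedEdges {Q : Finset (Site d)} {v : Site d} {m : ℕ} {e : Sym2 ↥Q}
    (he : e ∈ (finsetGraph (zdGraph d) Q).edgeFinset.filter
      (fun e => Sym2.map Subtype.val e ∈ edgesIn (zdGraph d) (GM.ball v m)))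
    {x : ↥Q} (hx : x ∈ e) : (x : Site d) ∈ GM.ball v m := by
  have h := (mem_edgesIn_iff.1 (Finset.mem_filter.1 he).2).2
  exact h x.1 (Sym2.mem_map.2 ⟨x, hx, rfl⟩)

end Weights

/-! ### §3 The seed of an origin-star-convex region is joined to the origin through seed edges -/

section Seed

variable {d : ℕ}

/-- **Coordinate descent inside the seed.** Let `Q ∋ 0` be origin-star-convex along coordinate moves (moving one
coordinate of a point of `Q` towards `0` stays in `Q`). Then every point of `Q ∩ Λ_m` is joined to `0` by lattice
edges with both end points in `Q ∩ Λ_m`, i.e. through the seed edges of the induced graph of `Q`. (The tree's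
`box_induce_reachable_zero` is the case `Q = Λ_n`.) [folklore] -/
theorem seed_reachable_zero (Q : Finset (Site d)) (h0 : (0 : Site d) ∈ Q)
    (hconv : ∀ x ∈ Q, ∀ (i : Fin d) (t : ℤ), (0 ≤ t ∧ t ≤ x i) ∨ (x i ≤ t ∧ t ≤ 0) → Function.update x i t ∈ Q)
    (m : ℕ) (x : ↥Q) (hx : (x : Site d) ∈ GM.ball (0 : Site d) m) :
    (fromEdgeSet (↑((finsetGraph (zdGraph d) Q).edgeFinset.filter
        (fun e => Sym2.map Subtype.val e ∈ edgesIn (zdGraph d) (GM.ball (0 : Site d) m))) : Set (Sym2 ↥Q))).Reachable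
      x ⟨0, h0⟩ := by
  set H : SimpleGraph ↥Q := fromEdgeSet (↑((finsetGraph (zdGraph d) Q).edgeFinset.filter
        (fun e => Sym2.map Subtype.val e ∈ edgesIn (zdGraph d) (GM.ball (0 : Site d) m))) : Set (Sym2 ↥Q)) with hH
  suffices key : ∀ n : ℕ, ∀ (y : Site d) (hy : y ∈ Q), y ∈ GM.ball (0 : Site d) m → ∑ i, (y i).natAbs = n →
      H.Reachable ⟨y, hy⟩ ⟨0, h0⟩ from key _ x.1 x.2 hx rfl
  intro n
  induction n using Nat.strong_induction_on with
  | _ n ih =>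
    intro y hy hyb hn
    by_cases hy0 : y = 0
    · subst hy0; rfl
    · obtain ⟨i, hi⟩ : ∃ i, y i ≠ 0 := by
        by_contra h
        push Not at h
        exact hy0 (funext h)
      rw [GM.ball_zero, mem_box] at hyb
      -- one step towards the origin in direction `i`
      set t : ℤ := if 0 < y i then y i - 1 else y i + 1 with ht
      set y' : Site d := Function.update y i t with hy'
      have hy'j : ∀ j, j ≠ i → y' j = y j := fun j hj => by simp [hy', hj]
      have hy'i : y' i = t := by simp [hy']
      have hy'Q : y' ∈ Q := by
        refine hconv y hy i t ?_
        by_cases hpos : 0 < y i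
        · left; rw [ht, if_pos hpos]; omega
        · right; rw [ht, if_neg hpos]; omega
      have hy'b : y' ∈ GM.ball (0 : Site d) m := by
        rw [GM.ball_zero, mem_box]
        intro j
        rcases eq_or_ne j i with rfl | hj
        · rw [hy'i, ht]; have := hyb j; split_ifs <;> omega
        · rw [hy'j j hj]; exact hyb j
      have hyb' : y ∈ GM.ball (0 : Site d) m := by rw [GM.ball_zero, mem_box]; exact hyb
      have hadj : (zdGraph d).Adj y y' := by
        rw [zdGraph_adj_iff]
        refine ⟨i, ?_⟩
        by_cases hpos : 0 < y i
        · right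
          funext j
          rcases eq_or_ne j i with rfl | hj
          · simp [hy'i, ht, hpos]
          · simp [hy'j j hj, hj]
        · left
          funext j
          rcases eq_or_ne j i with rfl | hj
          · simp [hy'i, ht, hpos]
          · simp [hy'j j hj, hj]
      have hlt : ∑ j, (y' j).natAbs < n := by
        rw [← hn]
        apply Finset.sum_lt_sum
        · intro j _
          rcases eq_or_ne j i with rfl | hj
          · rw [hy'i, ht]; split_ifs <;> omega
          · rw [hy'j j hj]
        · refine ⟨i, Finset.mem_univ _, ?_⟩
          rw [hy'i, ht]; split_ifs <;> omega
      have hstep : H.Adj ⟨y, hy⟩ ⟨y', hy'Q⟩ := by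
        rw [hH, fromEdgeSet_adj]
        refine ⟨?_, fun h => hadj.ne (congrArg Subtype.val h)⟩
        rw [Finset.mem_coe, Finset.mem_filter, SimpleGraph.mem_edgeFinset, SimpleGraph.mem_edgeSet, Sym2.map_mk]
        refine ⟨hadj, mem_edgesIn_iff.2 ⟨by rw [SimpleGraph.mem_edgeSet]; exact hadj, fun z hz => ?_⟩⟩
        rcases Sym2.mem_iff.1 hz with rfl | rfl
        · exact hyb'
        · exact hy'b
      exact hstep.reachable.trans (ih _ hlt y' hy'Q hy'b rfl)

/-- **Boxes `ℓQ_g ∋ 0` are origin-star-convex**: if `0 ∈ ℓQ_g` then moving one coordinate of a point of `ℓQ_g`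
towards `0` stays in `ℓQ_g`. [folklore] -/
theorem update_mem_Qset_of_between (g : Geom d) {ℓ : ℕ} (h0 : (0 : Site d) ∈ g.Qset ℓ 0) {x : Site d}
    (hx : x ∈ g.Qset ℓ 0) (i : Fin d) (t : ℤ) (ht : (0 ≤ t ∧ t ≤ x i) ∨ (x i ≤ t ∧ t ≤ 0)) :
    Function.update x i t ∈ g.Qset ℓ 0 := by
  rw [Geom.Qset, mem_Icc_iff] at h0 hx ⊢
  intro j
  rcases eq_or_ne j i with rfl | hj
  · rw [Function.update_self]
    have h0j := h0 j
    have hxj := hx j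
    simp only [Pi.zero_apply] at h0j
    rcases ht with ⟨h1, h2⟩ | ⟨h1, h2⟩
    · exact ⟨h0j.1.trans h1, h2.trans hxj.2⟩
    · exact ⟨hxj.1.trans h1, h2.trans h0j.2⟩
  · rw [Function.update_of_ne hj]
    exact hx j

end Seed

/-! ### §4 The bridge: the free look of the transplant is a homogeneous random-cluster measure with the seed wired -/

section Bridge

variable {d : ℕ}

/-- **The free look with its wired seed is a homogeneous random-cluster measure.** For a geometry `g`, a scale `ℓ`
with `0 ∈ ℓQ_g`, a seed radius `m`, `0 < p ≤ 1`, `0 < q` and a measurable event `A` of bond configurations of `ℤ^d`: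
`fkLaw ℓQ (hitW p g ℓ m 0) q (A) = φ^{W}_{⟨U⟩, p, q}({η | η ∪ S ∈ liftEdges ℓQ ⁻¹ A})`, where, on the vertex type
`↥ℓQ`: `S` = the lattice edges of `ℓQ` inside `Λ_m` (seed edges), `U` = the other lattice edges of `ℓQ`,
`W = ℓQ ∩ Λ_m` (the seed, wired), `⟨U⟩ = fromEdgeSet U`. The right-hand side is the kind of measure T1m's
comparison `rcMeasure_real_le_of_slope` speaks about. [cite: Grimmett2006, Thm. (3.7) (p. 39), Lemma (4.13) (p. 71), §1.4 eq. (1.20); KozmaNitzan2024, §4 p. 16] -/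
theorem fkLaw_hitW_real_eq_rcMeasure_seedWired {q : ℝ} (hq : 0 < q) (p : unitInterval) (hp0 : 0 < (p : ℝ))
    (g : Geom d) {ℓ : ℕ} (h0 : (0 : Site d) ∈ g.Qset ℓ 0) (m : ℕ)
    {A : Set (BondConfig (Site d))} (hA : MeasurableSet A) :
    (fkLaw (g.Qset ℓ 0) (hitW p g ℓ m 0) q).real A =
      (rcMeasure
          (fromEdgeSet (↑((finsetGraph (zdGraph d) (g.Qset ℓ 0)).edgeFinset \
              (finsetGraph (zdGraph d) (g.Qset ℓ 0)).edgeFinset.filter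
                (fun e => Sym2.map Subtype.val e ∈ edgesIn (zdGraph d) (GM.ball (0 : Site d) m))) :
            Set (Sym2 ↥(g.Qset ℓ 0))))
          p q {x : ↥(g.Qset ℓ 0) | (x : Site d) ∈ GM.ball (0 : Site d) m}).real
        {η : BondConfig ↥(g.Qset ℓ 0) |
          η ∪ ↑((finsetGraph (zdGraph d) (g.Qset ℓ 0)).edgeFinset.filter
              (fun e => Sym2.map Subtype.val e ∈ edgesIn (zdGraph d) (GM.ball (0 : Site d) m))) ∈
            liftEdges (g.Qset ℓ 0) ⁻¹' A} := by
  rw [fkLaw_real_apply _ _ q hA, hitW_eq_restrW_pinW, restrW_pinW_lattW_comp_sym2Map_eq_condWeights]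
  refine rcMeasureW_condWeights_real_eq_rcMeasure_fromEdgeSet (finsetGraph (zdGraph d) (g.Qset ℓ 0)) p hp0 hq
    (Finset.filter_subset _ _) (x₀ := ⟨0, h0⟩) (W := {x : ↥(g.Qset ℓ 0) | (x : Site d) ∈ GM.ball (0 : Site d) m})
    (by show (0 : Site d) ∈ GM.ball (0 : Site d) m; exact GM.self_mem_ball 0 m)
    (fun e he x hx => mem_ball_of_mem_seedEdges he hx)
    (fun x hx => seed_reachable_zero (g.Qset ℓ 0) h0 (fun y hy i t ht => update_mem_Qset_of_between g h0 hy i t ht) m x hx) _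

end Bridge

end Summit.CriticalPhenomena.PercolationContinuityZ3.Theorems.FK

end
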